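import Literature.Computability.Complexity.HardcoreInapproximabilityCyclesTuples
import HarnessLib

/-!
# Short cycles of Sly's random bipartite core, IV: vertex-disjoint tuples (main term of `E[X_i]_m`)

Allan Sly, *Computational transition at the uniqueness threshold*, FOCS 2010 (arXiv:1005.5584), §3.2
(Lemma 3.7, after MWW09 Lemma 7.3: "a straightforward generalisation").

The factorial moments `(2j)^m E[(X_{2j})_m] = E[slyDistinctTuples … m]` (part III) are sums over
ordered `m`-tuples `f` of rooted oriented `2j`-cycles with pairwise distinct underlying cycles of
`P(all f k present)`. This file evaluates the MAIN TERM, the vertex-disjoint tuples, exactly: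

* `card_realisations_with_edges`, `card_present_tuple`: realisations containing a coloured edge set
  whose colour classes are partial matchings number `Π_c (n+m' - |E_c|)! · (n - |E_τ|)!`; for a
  vertex-disjoint tuple the classes have sizes `Σ_k k_c(f k)`.
* `reps_ne_of_vertexDisjoint`: vertex-disjoint cycles have distinct underlying cycles, so the
  vertex-disjoint tuples are counted in `slyDistinctTuples` (`sum_disjoint_le_sum_slyDistinctTuples`,
  via the double count `sum_slyDistinctTuples`).
* `slyDisjointTupleEquiv`, `card_slyDisjointTuples_pattern`: the vertex-disjoint tuples with prescribed
  colour patterns are the pairs of injections `Fin m × Fin j ↪ Fin n` (positions), `(n^{(mj)})²` of them.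
* `descFactorial_term_bounds`, `sum_disjoint_div_bounds`: the normalised main term lies between
  `(q^{2j}+q)^m ((n-mj)/(n+m'))^{2mj}` and `(q^{2j}+q)^m (n/(n-2mj))^{2mj}`; in particular
  `avg_slyDistinctTuples_ge`: `E[(2j)^m (X_{2j})_m] ≥ (q^{2j}+q)^m ((n-mj)/(n+m'))^{2mj}` for all `n > 2mj`
  (the lower half of Lemma 3.7's `E[X_i]_m → λ_i^m`, `λ_{2j} = (q^{2j}+q)/(2j)`).

The complementary upper bound needs the overlapping tuples (`O(1/n)`, part V). No named facts.
[cite: Sly2010, Lemma 3.7]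
-/

namespace Literature.Computability.Complexity

open Finset

section EdgeSets

variable {n m' q : ℕ}

open scoped Classical in
/-- **Realisations containing a prescribed coloured edge set** (general form of `SlyWCycle.card_present`):
if within each colour class the plus endpoints are distinct and the minus endpoints are distinct (each
colour class is a partial matching), the number of `(σ, τ)` containing all the edges is
`Π_c (n + m' - |E_c|)! · (n - |E_τ|)!`. [cite: Sly2010, Lemma 3.7 (proof, `P1`)] -/
theorem card_realisations_with_edges {ι : Type*} (E : Finset ι) (col : ι → Option (Fin q)) (pe me : ι → Fin n)
    (hP : ∀ c, Set.InjOn pe (E.filter fun e => col e = c)) (hM : ∀ c, Set.InjOn me (E.filter fun e => col e = c)) :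
    Fintype.card {ω : (Fin q → Equiv.Perm (Fin (n + m'))) × Equiv.Perm (Fin n) //
        (∀ c : Fin q, ∀ e ∈ E.filter (fun e => col e = some c), ω.1 c (Fin.castAdd m' (pe e)) = Fin.castAdd m' (me e)) ∧
          ∀ e ∈ E.filter (fun e => col e = none), ω.2 (pe e) = me e} =
      (∏ c : Fin q, (n + m' - (E.filter fun e => col e = some c).card).factorial) * (n - (E.filter fun e => col e = none).card).factorial := by
  have e1 : {ω : (Fin q → Equiv.Perm (Fin (n + m'))) × Equiv.Perm (Fin n) //
        (∀ c : Fin q, ∀ e ∈ E.filter (fun e => col e = some c), ω.1 c (Fin.castAdd m' (pe e)) = Fin.castAdd m' (me e)) ∧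
          ∀ e ∈ E.filter (fun e => col e = none), ω.2 (pe e) = me e} ≃
      {σ : Fin q → Equiv.Perm (Fin (n + m')) //
          ∀ c : Fin q, ∀ e ∈ E.filter (fun e => col e = some c), σ c (Fin.castAdd m' (pe e)) = Fin.castAdd m' (me e)} ×
        {τ : Equiv.Perm (Fin n) // ∀ e ∈ E.filter (fun e => col e = none), τ (pe e) = me e} :=
    { toFun := fun ω => ⟨⟨ω.1.1, ω.2.1⟩, ⟨ω.1.2, ω.2.2⟩⟩
      invFun := fun p => ⟨(p.1.1, p.2.1), p.1.2, p.2.2⟩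
      left_inv := fun ω => rfl
      right_inv := fun p => rfl }
  have e2 : {σ : Fin q → Equiv.Perm (Fin (n + m')) //
      ∀ c : Fin q, ∀ e ∈ E.filter (fun e => col e = some c), σ c (Fin.castAdd m' (pe e)) = Fin.castAdd m' (me e)} ≃
      ∀ c : Fin q, {π : Equiv.Perm (Fin (n + m')) // ∀ e ∈ E.filter (fun e => col e = some c), π (Fin.castAdd m' (pe e)) = Fin.castAdd m' (me e)} :=
    { toFun := fun σ c => ⟨σ.1 c, σ.2 c⟩
      invFun := fun f => ⟨fun c => (f c).1, fun c => (f c).2⟩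
      left_inv := fun σ => rfl
      right_inv := fun f => rfl }
  rw [Fintype.card_congr e1, Fintype.card_prod, Fintype.card_congr e2, Fintype.card_pi]
  congr 1
  · refine Finset.prod_congr rfl fun c _ => ?_
    have h := card_perm_forall_mem_apply_eq (E.filter fun e => col e = some c) (fun e => Fin.castAdd m' (pe e)) (fun e => Fin.castAdd m' (me e))
      (fun e he e' he' h => hP (some c) he he' (Fin.castAdd_injective _ _ h))
      (fun e he e' he' h => hM (some c) he he' (Fin.castAdd_injective _ _ h))
    rw [Fintype.card_fin] at h
    convert h using 2
  · have h := card_perm_forall_mem_apply_eq (E.filter fun e => col e = none) pe me (hP none) (hM none)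
    rw [Fintype.card_fin] at h
    convert h using 2

end EdgeSets

section DisjointTuples

variable {n m' q j : ℕ}

/-- A tuple of rooted cycles is **vertex-disjoint** (and each cycle has distinct vertices) iff the
global vertex maps `(k, t) ↦ v_t(f k)`, `(k, t) ↦ w_t(f k)` are injective. [folklore] -/
def SlyVertexDisjoint {m : ℕ} (f : Fin m → SlyWCycle n q j) : Prop :=
  (Function.Injective fun p : Fin m × Fin j => (f p.1).v p.2) ∧ Function.Injective fun p : Fin m × Fin j => (f p.1).w p.2

/-- The cycle-vertex index of the plus endpoint of an edge. [folklore] -/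
def slyPlusIdx (j : ℕ) : Fin j ⊕ Fin j → Fin j
  | Sum.inl t => t
  | Sum.inr t => finRotate j t

/-- The plus endpoint via the vertex index. [folklore] -/
theorem SlyWCycle.plusEnd_eq (C : SlyWCycle n q j) (e : Fin j ⊕ Fin j) : C.plusEnd e = C.v (slyPlusIdx j e) := by
  cases e <;> rfl

/-- The cycle-vertex index of the minus endpoint of an edge. [folklore] -/
def slyMinusIdx (j : ℕ) : Fin j ⊕ Fin j → Fin j
  | Sum.inl t => t
  | Sum.inr t => t

/-- The minus endpoint via the vertex index. [folklore] -/
theorem SlyWCycle.minusEnd_eq (C : SlyWCycle n q j) (e : Fin j ⊕ Fin j) : C.minusEnd e = C.w (slyMinusIdx j e) := by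
  cases e <;> rfl

open scoped Classical in
/-- **Realisations containing a vertex-disjoint tuple of cycles**:
`#{(σ,τ) ⊇ ⋃_k f k} = Π_c (n+m' - Σ_k k_c(f k))! · (n - Σ_k k_τ(f k))!`. [cite: Sly2010, Lemma 3.7 (proof)] -/
theorem card_present_tuple {m : ℕ} (f : Fin m → SlyWCycle n q j) (hf : SlyVertexDisjoint f) :
    Fintype.card {ω : (Fin q → Equiv.Perm (Fin (n + m'))) × Equiv.Perm (Fin n) // ∀ k, (f k).Present ω.1 ω.2} =
      (∏ c : Fin q, (n + m' - ∑ k, (f k).colourCount (some c)).factorial) * (n - ∑ k, (f k).colourCount none).factorial := by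
  -- the coloured edge set of the union
  let E : Finset (Fin m × (Fin j ⊕ Fin j)) := univ
  let col : Fin m × (Fin j ⊕ Fin j) → Option (Fin q) := fun p => (f p.1).colour p.2
  let pe : Fin m × (Fin j ⊕ Fin j) → Fin n := fun p => (f p.1).plusEnd p.2
  let me : Fin m × (Fin j ⊕ Fin j) → Fin n := fun p => (f p.1).minusEnd p.2
  have hP : ∀ c, Set.InjOn pe (E.filter fun e => col e = c) := by
    intro c p hp p' hp' h
    simp only [E, Finset.coe_filter, Finset.mem_univ, true_and, Set.mem_setOf_eq, col] at hp hp'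
    simp only [pe, SlyWCycle.plusEnd_eq] at h
    have hk := hf.1 (a₁ := (p.1, slyPlusIdx j p.2)) (a₂ := (p'.1, slyPlusIdx j p'.2)) h
    have hk1 : p.1 = p'.1 := (Prod.mk.inj hk).1
    obtain ⟨k, e⟩ := p
    obtain ⟨k', e'⟩ := p'
    simp only at hk1; subst hk1
    have := (f k).injOn_plusEnd c (by simpa [SlyWCycle.edgesOf] using hp) (by simpa [SlyWCycle.edgesOf] using hp')
      (by simpa [SlyWCycle.plusEnd_eq] using h)
    rw [this]
  have hM : ∀ c, Set.InjOn me (E.filter fun e => col e = c) := by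
    intro c p hp p' hp' h
    simp only [E, Finset.coe_filter, Finset.mem_univ, true_and, Set.mem_setOf_eq, col] at hp hp'
    simp only [me, SlyWCycle.minusEnd_eq] at h
    have hk := hf.2 (a₁ := (p.1, slyMinusIdx j p.2)) (a₂ := (p'.1, slyMinusIdx j p'.2)) h
    have hk1 : p.1 = p'.1 := (Prod.mk.inj hk).1
    obtain ⟨k, e⟩ := p
    obtain ⟨k', e'⟩ := p'
    simp only at hk1; subst hk1
    have := (f k).injOn_minusEnd c (by simpa [SlyWCycle.edgesOf] using hp) (by simpa [SlyWCycle.edgesOf] using hp')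
      (by simpa [SlyWCycle.minusEnd_eq] using h)
    rw [this]
  have hcard := card_realisations_with_edges (m' := m') E col pe me hP hM
  -- identify the presence predicate and the class sizes
  have hpres : ∀ ω : (Fin q → Equiv.Perm (Fin (n + m'))) × Equiv.Perm (Fin n),
      (∀ k, (f k).Present ω.1 ω.2) ↔
        ((∀ c : Fin q, ∀ e ∈ E.filter (fun e => col e = some c), ω.1 c (Fin.castAdd m' (pe e)) = Fin.castAdd m' (me e)) ∧
          ∀ e ∈ E.filter (fun e => col e = none), ω.2 (pe e) = me e) := by
    intro ω
    simp only [E, Finset.mem_filter, Finset.mem_univ, true_and, col, pe, me, Prod.forall]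
    constructor
    · intro h
      refine ⟨fun c k e he => ?_, fun k e he => ?_⟩
      · exact ((f k).present_iff ω.1 ω.2).1 (h k) |>.1 c e (by simpa [SlyWCycle.edgesOf] using he)
      · exact ((f k).present_iff ω.1 ω.2).1 (h k) |>.2 e (by simpa [SlyWCycle.edgesOf] using he)
    · rintro ⟨h1, h2⟩ k
      refine ((f k).present_iff ω.1 ω.2).2 ⟨fun c e he => h1 c k e (by simpa [SlyWCycle.edgesOf] using he),
        fun e he => h2 k e (by simpa [SlyWCycle.edgesOf] using he)⟩
  have hclass : ∀ c : Option (Fin q), (E.filter fun e => col e = c).card = ∑ k, (f k).colourCount c := by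
    intro c
    simp only [E, col]
    rw [Finset.card_filter, Fintype.sum_prod_type]
    refine Finset.sum_congr rfl fun k _ => ?_
    rw [← Finset.card_filter, ← (f k).card_edgesOf c]
    rfl
  rw [Fintype.card_congr (Equiv.subtypeEquivRight hpres)]
  simp only [hclass] at hcard
  convert hcard using 2

end DisjointTuples

section DisjointMain

variable {n m' q j : ℕ}

/-- Re-rooting does not change the set of plus vertices. [folklore] -/
theorem SlyWCycle.range_v_iterate_rotate (C : SlyWCycle n q j) (s : ℕ) :
    Set.range (SlyWCycle.rotate^[s] C).v = Set.range C.v := by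
  rw [SlyWCycle.iterate_rotate_v]
  exact ((finRotate j).surjective.iterate s).range_comp C.v

/-- Reflection does not change the set of plus vertices. [folklore] -/
theorem SlyWCycle.range_v_reflect (C : SlyWCycle n q j) : Set.range C.reflect.v = Set.range C.v := by
  have : C.reflect.v = C.v ∘ (finRotate j ∘ Fin.rev) := rfl
  rw [this]
  exact ((finRotate j).surjective.comp Fin.rev_surjective).range_comp C.v

/-- Representatives have the same plus vertex set. [folklore] -/
theorem SlyWCycle.range_v_of_mem_reps {C D : SlyWCycle n q j} (h : D ∈ C.reps) : Set.range D.v = Set.range C.v := by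
  obtain ⟨s, e, rfl⟩ := SlyWCycle.mem_reps.1 h
  rw [SlyWCycle.range_v_iterate_rotate]
  cases e
  · rfl
  · exact C.range_v_reflect

/-- **Vertex-disjoint cycles have different underlying cycles.** [folklore] -/
theorem reps_ne_of_vertexDisjoint (hj : 0 < j) {m : ℕ} {f : Fin m → SlyWCycle n q j} (hf : SlyVertexDisjoint f)
    {k l : Fin m} (hkl : k ≠ l) : (f k).reps ≠ (f l).reps := by
  intro heq
  have hmem : f l ∈ (f k).reps := heq ▸ SlyWCycle.self_mem_reps hj (f l)
  have hr := SlyWCycle.range_v_of_mem_reps hmem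
  have : (f l).v ⟨0, hj⟩ ∈ Set.range (f k).v := hr ▸ Set.mem_range_self _
  obtain ⟨t, ht⟩ := this
  have := hf.1 (a₁ := (k, t)) (a₂ := (l, ⟨0, hj⟩)) ht
  exact hkl (Prod.mk.inj this).1

open scoped Classical in
/-- **Double counting the tuples**: `Σ_ω (2j)^m (X)_m(ω) = Σ_{f with distinct reps} #{ω ⊇ ⋃ f}`. [cite: Sly2010, Lemma 3.7] -/
theorem sum_slyDistinctTuples (m : ℕ) :
    ∑ ω : (Fin q → Equiv.Perm (Fin (n + m'))) × Equiv.Perm (Fin n), slyDistinctTuples n m' q j m ω.1 ω.2 =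
      ∑ f : Fin m → SlyWCycle n q j, if (∀ k l, k ≠ l → (f k).reps ≠ (f l).reps) then
        Fintype.card {ω : (Fin q → Equiv.Perm (Fin (n + m'))) × Equiv.Perm (Fin n) // ∀ k, (f k).Present ω.1 ω.2} else 0 := by
  unfold slyDistinctTuples
  have h : ∀ ω : (Fin q → Equiv.Perm (Fin (n + m'))) × Equiv.Perm (Fin n),
      (univ.filter fun f : Fin m → SlyWCycle n q j => (∀ k, (f k).Present ω.1 ω.2) ∧ ∀ k l, k ≠ l → (f k).reps ≠ (f l).reps).card =
        ∑ f : Fin m → SlyWCycle n q j, if (∀ k, (f k).Present ω.1 ω.2) ∧ (∀ k l, k ≠ l → (f k).reps ≠ (f l).reps) then 1 else 0 := by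
    intro ω; rw [Finset.card_filter]
  simp_rw [h]
  rw [Finset.sum_comm]
  refine Finset.sum_congr rfl fun f _ => ?_
  by_cases hd : ∀ k l, k ≠ l → (f k).reps ≠ (f l).reps
  · rw [if_pos hd]
    simp only [and_iff_left hd]
    rw [← Finset.card_filter, Fintype.card_subtype]
  · rw [if_neg hd]
    simp only [iff_false_intro hd, and_false, if_false, Finset.sum_const_zero]

open scoped Classical in
/-- **Lower bound by the vertex-disjoint tuples** (exact value of their contribution):
`Σ_ω (2j)^m (X)_m(ω) ≥ Σ_{f vertex-disjoint} Π_c (n+m' - K_c(f))! (n - K_τ(f))!`. [cite: Sly2010, Lemma 3.7 (proof)] -/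
theorem sum_disjoint_le_sum_slyDistinctTuples (hj : 0 < j) (m : ℕ) :
    (∑ f : Fin m → SlyWCycle n q j, if SlyVertexDisjoint f then
        (∏ c : Fin q, (n + m' - ∑ k, (f k).colourCount (some c)).factorial) * (n - ∑ k, (f k).colourCount none).factorial else 0) ≤
      ∑ ω : (Fin q → Equiv.Perm (Fin (n + m'))) × Equiv.Perm (Fin n), slyDistinctTuples n m' q j m ω.1 ω.2 := by
  rw [sum_slyDistinctTuples]
  refine Finset.sum_le_sum fun f _ => ?_
  by_cases hf : SlyVertexDisjoint f
  · rw [if_pos hf, if_pos (fun k l hkl => reps_ne_of_vertexDisjoint hj hf hkl), card_present_tuple f hf]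
  · rw [if_neg hf]; exact Nat.zero_le _

/-- Vertex-disjoint tuples with prescribed patterns ↔ pairs of injections `Fin m × Fin j ↪ Fin n`. [folklore] -/
def slyDisjointTupleEquiv {m : ℕ} (ξ : Fin m → SlyColourPattern q j) :
    {f : Fin m → SlyWCycle n q j // SlyVertexDisjoint f ∧ (fun k => (f k).pattern) = ξ} ≃
      (Fin m × Fin j ↪ Fin n) × (Fin m × Fin j ↪ Fin n) where
  toFun f := (⟨fun p => (f.1 p.1).v p.2, f.2.1.1⟩, ⟨fun p => (f.1 p.1).w p.2, f.2.1.2⟩)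
  invFun VW := ⟨fun k => ⟨fun t => VW.1 (k, t), fun t => VW.2 (k, t), (ξ k).1.1, (ξ k).1.2,
      fun t t' h => by have := VW.1.injective h; simpa using this,
      fun t t' h => by have := VW.2.injective h; simpa using this, (ξ k).2.1, (ξ k).2.2⟩,
    ⟨⟨fun p p' h => by
        have := VW.1.injective (a₁ := (p.1, p.2)) (a₂ := (p'.1, p'.2)) h
        exact Prod.ext (Prod.mk.inj this).1 (Prod.mk.inj this).2,
      fun p p' h => by
        have := VW.2.injective (a₁ := (p.1, p.2)) (a₂ := (p'.1, p'.2)) h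
        exact Prod.ext (Prod.mk.inj this).1 (Prod.mk.inj this).2⟩,
      funext fun k => rfl⟩⟩
  left_inv f := by
    obtain ⟨f, hf, rfl⟩ := f
    rfl
  right_inv VW := by
    obtain ⟨V, W⟩ := VW
    rfl

open scoped Classical in
/-- The number of vertex-disjoint tuples with prescribed patterns: `(n^{(mj)})²`. [cite: Sly2010, Lemma 3.7 (proof: positions)] -/
theorem card_slyDisjointTuples_pattern {m : ℕ} (ξ : Fin m → SlyColourPattern q j) :
    Fintype.card {f : Fin m → SlyWCycle n q j // SlyVertexDisjoint f ∧ (fun k => (f k).pattern) = ξ} =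
      n.descFactorial (m * j) * n.descFactorial (m * j) := by
  rw [Fintype.card_congr (slyDisjointTupleEquiv ξ), Fintype.card_prod, Fintype.card_embedding_eq, Fintype.card_prod,
    Fintype.card_fin, Fintype.card_fin, Fintype.card_fin]

open scoped Classical in
/-- Summing a function of the pattern tuple over the vertex-disjoint tuples. [folklore] -/
theorem sum_disjoint_pattern {m : ℕ} {M : Type*} [AddCommMonoid M] (F : (Fin m → SlyColourPattern q j) → M) :
    (∑ f : Fin m → SlyWCycle n q j, if SlyVertexDisjoint f then F (fun k => (f k).pattern) else 0) =
      ∑ ξ : Fin m → SlyColourPattern q j, (n.descFactorial (m * j) * n.descFactorial (m * j)) • F ξ := by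
  rw [← Finset.sum_fiberwise_of_maps_to (s := (univ : Finset (Fin m → SlyWCycle n q j)))
    (t := (univ : Finset (Fin m → SlyColourPattern q j))) (g := fun f k => (f k).pattern) (fun _ _ => Finset.mem_univ _)]
  refine Finset.sum_congr rfl fun ξ _ => ?_
  rw [Finset.sum_filter, ← Finset.sum_filter_add_sum_filter_not univ (fun f : Fin m → SlyWCycle n q j => SlyVertexDisjoint f)]
  rw [Finset.sum_congr rfl (fun f hf => by
      rw [if_pos (Finset.mem_filter.1 hf).2]
      : ∀ f ∈ univ.filter (fun f : Fin m → SlyWCycle n q j => SlyVertexDisjoint f),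
        (if (fun k => (f k).pattern) = ξ then (if SlyVertexDisjoint f then F (fun k => (f k).pattern) else 0) else 0) =
          if (fun k => (f k).pattern) = ξ then F (fun k => (f k).pattern) else 0)]
  rw [Finset.sum_congr rfl (fun f hf => by
      rw [if_neg (Finset.mem_filter.1 hf).2, ite_self]
      : ∀ f ∈ univ.filter (fun f : Fin m → SlyWCycle n q j => ¬SlyVertexDisjoint f),
        (if (fun k => (f k).pattern) = ξ then (if SlyVertexDisjoint f then F (fun k => (f k).pattern) else 0) else 0) = 0)]
  rw [Finset.sum_const_zero, add_zero, ← Finset.sum_filter]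
  rw [Finset.filter_filter]
  rw [Finset.sum_congr rfl (fun f hf => by rw [(Finset.mem_filter.1 hf).2.2]
      : ∀ f ∈ univ.filter (fun f : Fin m → SlyWCycle n q j => SlyVertexDisjoint f ∧ (fun k => (f k).pattern) = ξ),
        F (fun k => (f k).pattern) = F ξ)]
  rw [Finset.sum_const, ← card_slyDisjointTuples_pattern ξ, ← Fintype.card_subtype]

end DisjointMain

section TupleTermBounds

variable {q : ℕ}

/-- **Two-sided bounds on a normalised configuration term** (general colour counts): if
`Σ_c K_c = 2J` and `2J < n`, then `((n-J)/(n+m'))^{2J} ≤ (n^{(J)})² / (Π_c N^{(K_c)} · n^{(K_τ)}) ≤ (n/(n-2J))^{2J}`.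
[cite: Sly2010, Lemma 3.7 (proof)] -/
theorem descFactorial_term_bounds (n m' J : ℕ) (K : Option (Fin q) → ℕ) (hsum : ∑ c, K c = 2 * J) (hn : 2 * J < n) :
    (((n : ℝ) - J) / ((n : ℝ) + m')) ^ (2 * J) ≤
        (n.descFactorial J : ℝ) ^ 2 / ((∏ c : Fin q, ((n + m').descFactorial (K (some c)) : ℝ)) * (n.descFactorial (K none) : ℝ)) ∧
      (n.descFactorial J : ℝ) ^ 2 / ((∏ c : Fin q, ((n + m').descFactorial (K (some c)) : ℝ)) * (n.descFactorial (K none) : ℝ)) ≤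
        ((n : ℝ) / ((n : ℝ) - 2 * J)) ^ (2 * J) := by
  have hkc : ∀ c : Option (Fin q), K c ≤ 2 * J := fun c => by
    rw [← hsum]; exact Finset.single_le_sum (fun _ _ => Nat.zero_le _) (Finset.mem_univ c)
  have hn0 : (0 : ℝ) < n := by exact_mod_cast (show 0 < n by omega)
  have hnj : (0 : ℝ) < (n : ℝ) - J := by
    have : (J : ℝ) < n := by exact_mod_cast (show J < n by omega)
    linarith
  have hn2j : (0 : ℝ) < (n : ℝ) - 2 * J := by
    have : ((2 * J : ℕ) : ℝ) < n := by exact_mod_cast hn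
    push_cast at this; linarith
  have hN : (n : ℝ) ≤ (n : ℝ) + m' := by have := (Nat.cast_nonneg m' : (0:ℝ) ≤ m'); linarith
  have hnum_lo : ((n : ℝ) - J) ^ J ≤ (n.descFactorial J : ℝ) := by
    have h := Nat.pow_sub_le_descFactorial n J
    have h' : (((n + 1 - J) ^ J : ℕ) : ℝ) ≤ (n.descFactorial J : ℝ) := by exact_mod_cast h
    refine le_trans ?_ h'
    push_cast [show J ≤ n + 1 by omega]
    exact pow_le_pow_left₀ hnj.le (by linarith) J
  have hnum_hi : (n.descFactorial J : ℝ) ≤ (n : ℝ) ^ J := by exact_mod_cast Nat.descFactorial_le_pow n J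
  have hden_hi : ∀ (N k : ℕ), (N.descFactorial k : ℝ) ≤ (N : ℝ) ^ k := fun N k => by exact_mod_cast Nat.descFactorial_le_pow N k
  have hden_lo : ∀ (N k : ℕ), k ≤ 2 * J → n ≤ N → ((n : ℝ) - 2 * J) ^ k ≤ (N.descFactorial k : ℝ) := by
    intro N k hk hNn
    have h := Nat.pow_sub_le_descFactorial N k
    have h' : (((N + 1 - k : ℕ) : ℝ)) ^ k ≤ (N.descFactorial k : ℝ) := by exact_mod_cast h
    refine le_trans (pow_le_pow_left₀ hn2j.le ?_ k) h'
    rw [Nat.cast_sub (by omega : k ≤ N + 1)]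
    push_cast
    have : ((k : ℕ) : ℝ) ≤ 2 * J := by exact_mod_cast hk
    have : (n : ℝ) ≤ N := by exact_mod_cast hNn
    linarith
  set D : ℝ := (∏ c : Fin q, ((n + m').descFactorial (K (some c)) : ℝ)) * (n.descFactorial (K none) : ℝ) with hD
  have hsum' : (∑ c : Fin q, K (some c)) + K none = 2 * J := by
    rw [← hsum, Fintype.sum_option]; ring
  have hD_hi : D ≤ ((n : ℝ) + m') ^ (2 * J) := by
    have h1 : (∏ c : Fin q, ((n + m').descFactorial (K (some c)) : ℝ)) ≤ ∏ c : Fin q, ((n : ℝ) + m') ^ K (some c) :=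
      Finset.prod_le_prod (fun c _ => Nat.cast_nonneg _) fun c _ => by
        have := hden_hi (n + m') (K (some c)); push_cast at this; exact this
    have h2 : (n.descFactorial (K none) : ℝ) ≤ ((n : ℝ) + m') ^ K none :=
      (hden_hi n _).trans (pow_le_pow_left₀ hn0.le hN _)
    calc D ≤ (∏ c : Fin q, ((n : ℝ) + m') ^ K (some c)) * ((n : ℝ) + m') ^ K none :=
          mul_le_mul h1 h2 (Nat.cast_nonneg _) (Finset.prod_nonneg fun c _ => by positivity)
      _ = ((n : ℝ) + m') ^ (2 * J) := by
          rw [Finset.prod_pow_eq_pow_sum, ← pow_add, hsum']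
  have hD_lo : ((n : ℝ) - 2 * J) ^ (2 * J) ≤ D := by
    have h1 : (∏ c : Fin q, ((n : ℝ) - 2 * J) ^ K (some c)) ≤ ∏ c : Fin q, ((n + m').descFactorial (K (some c)) : ℝ) :=
      Finset.prod_le_prod (fun c _ => by positivity) fun c _ => hden_lo _ _ (hkc _) (Nat.le_add_right n m')
    have h2 : ((n : ℝ) - 2 * J) ^ K none ≤ (n.descFactorial (K none) : ℝ) := hden_lo _ _ (hkc _) le_rfl
    calc ((n : ℝ) - 2 * J) ^ (2 * J) = (∏ c : Fin q, ((n : ℝ) - 2 * J) ^ K (some c)) * ((n : ℝ) - 2 * J) ^ K none := by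
          rw [Finset.prod_pow_eq_pow_sum, ← pow_add, hsum']
      _ ≤ D := mul_le_mul h1 h2 (by positivity) (Finset.prod_nonneg fun c _ => Nat.cast_nonneg _)
  have hD0 : 0 < D := lt_of_lt_of_le (by positivity) hD_lo
  constructor
  · rw [div_pow, div_le_div_iff₀ (by positivity) hD0]
    calc ((n : ℝ) - J) ^ (2 * J) * D ≤ ((n : ℝ) - J) ^ (2 * J) * ((n : ℝ) + m') ^ (2 * J) :=
          mul_le_mul_of_nonneg_left hD_hi (by positivity)
      _ = (((n : ℝ) - J) ^ J) ^ 2 * ((n : ℝ) + m') ^ (2 * J) := by rw [← pow_mul, mul_comm J 2]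
      _ ≤ (n.descFactorial J : ℝ) ^ 2 * ((n : ℝ) + m') ^ (2 * J) :=
          mul_le_mul_of_nonneg_right (pow_le_pow_left₀ (by positivity) hnum_lo 2) (by positivity)
  · rw [div_pow, div_le_div_iff₀ hD0 (by positivity)]
    calc (n.descFactorial J : ℝ) ^ 2 * ((n : ℝ) - 2 * J) ^ (2 * J) ≤ ((n : ℝ) ^ J) ^ 2 * D :=
          mul_le_mul (pow_le_pow_left₀ (Nat.cast_nonneg _) hnum_hi 2) hD_lo (by positivity) (by positivity)
      _ = (n : ℝ) ^ (2 * J) * D := by rw [← pow_mul, mul_comm J 2]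

end TupleTermBounds

section DisjointMainBounds

variable {n m' q j : ℕ}

/-- The colour counts of a pattern tuple sum to `2mj`. [folklore] -/
theorem sum_tuple_count {m : ℕ} (ξ : Fin m → SlyColourPattern q j) :
    ∑ c : Option (Fin q), ∑ k, (ξ k).count c = 2 * (m * j) := by
  rw [Finset.sum_comm]
  simp_rw [SlyColourPattern.sum_count]
  rw [Finset.sum_const, Finset.card_univ, Fintype.card_fin, smul_eq_mul]; ring

open scoped Classical in
/-- **The vertex-disjoint main term, normalised and bounded on both sides**:
`(q^{2j}+q)^m ((n - mj)/(n+m'))^{2mj} ≤ Σ_{f disjoint} #{ω ⊇ ⋃f}/N_tot ≤ (q^{2j}+q)^m (n/(n-2mj))^{2mj}`.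
[cite: Sly2010, Lemma 3.7 (proof: main term of `E[X_i]_m`)] -/
theorem sum_disjoint_div_bounds (hj : 1 ≤ j) (m : ℕ) (hn : 2 * (m * j) < n) :
    ((q : ℝ) ^ (2 * j) + q) ^ m * (((n : ℝ) - (m * j : ℕ)) / ((n : ℝ) + m')) ^ (2 * (m * j)) ≤
        (∑ f : Fin m → SlyWCycle n q j, if SlyVertexDisjoint f then
          (((∏ c : Fin q, (n + m' - ∑ k, (f k).colourCount (some c)).factorial) * (n - ∑ k, (f k).colourCount none).factorial : ℕ) : ℝ)
          else 0) / ((((n + m').factorial : ℝ) ^ q) * (n.factorial : ℝ)) ∧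
      (∑ f : Fin m → SlyWCycle n q j, if SlyVertexDisjoint f then
          (((∏ c : Fin q, (n + m' - ∑ k, (f k).colourCount (some c)).factorial) * (n - ∑ k, (f k).colourCount none).factorial : ℕ) : ℝ)
          else 0) / ((((n + m').factorial : ℝ) ^ q) * (n.factorial : ℝ)) ≤
        ((q : ℝ) ^ (2 * j) + q) ^ m * ((n : ℝ) / ((n : ℝ) - 2 * (m * j : ℕ))) ^ (2 * (m * j)) := by
  -- the disjoint sum in pattern form
  set G : (Fin m → SlyColourPattern q j) → ℝ := fun ξ =>
    (((∏ c : Fin q, (n + m' - ∑ k, (ξ k).count (some c)).factorial) * (n - ∑ k, (ξ k).count none).factorial : ℕ) : ℝ) with hG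
  have hsumG : (∑ f : Fin m → SlyWCycle n q j, if SlyVertexDisjoint f then
      (((∏ c : Fin q, (n + m' - ∑ k, (f k).colourCount (some c)).factorial) * (n - ∑ k, (f k).colourCount none).factorial : ℕ) : ℝ)
      else 0) = ∑ ξ : Fin m → SlyColourPattern q j, (n.descFactorial (m * j) * n.descFactorial (m * j)) • G ξ := by
    rw [← sum_disjoint_pattern G]
    refine Finset.sum_congr rfl fun f _ => ?_
    simp only [hG, SlyWCycle.colourCount_eq]
  -- the normalised terms
  have hterm : ∀ ξ : Fin m → SlyColourPattern q j,
      ((n.descFactorial (m * j) * n.descFactorial (m * j)) • G ξ) / ((((n + m').factorial : ℝ) ^ q) * (n.factorial : ℝ)) =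
        (n.descFactorial (m * j) : ℝ) ^ 2 /
          ((∏ c : Fin q, ((n + m').descFactorial (∑ k, (ξ k).count (some c)) : ℝ)) * (n.descFactorial (∑ k, (ξ k).count none) : ℝ)) := by
    intro ξ
    have hkc : ∀ c : Option (Fin q), (∑ k, (ξ k).count c) ≤ n := fun c => by
      have h := Finset.single_le_sum (f := fun c => ∑ k, (ξ k).count c) (fun _ _ => Nat.zero_le _) (Finset.mem_univ c)
      rw [sum_tuple_count] at h
      omega
    have hfac : ∀ (N k : ℕ), k ≤ N → ((N - k).factorial : ℝ) = (N.factorial : ℝ) / (N.descFactorial k : ℝ) := by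
      intro N k hk
      have hpos : (0 : ℝ) < N.descFactorial k := by exact_mod_cast Nat.descFactorial_pos.2 hk
      rw [eq_div_iff hpos.ne']
      exact_mod_cast factorial_sub_mul_descFactorial hk
    rw [hG, nsmul_eq_mul]
    push_cast
    have hprod : (∏ c : Fin q, ((n + m' - ∑ k, (ξ k).count (some c)).factorial : ℝ)) =
        ∏ c : Fin q, (((n + m').factorial : ℝ) / ((n + m').descFactorial (∑ k, (ξ k).count (some c)) : ℝ)) :=
      Finset.prod_congr rfl fun c _ => hfac _ _ ((hkc (some c)).trans (Nat.le_add_right n m'))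
    rw [hprod, hfac n _ (hkc none), Finset.prod_div_distrib, Finset.prod_const, Finset.card_univ, Fintype.card_fin]
    have hP : (∏ c : Fin q, ((n + m').descFactorial (∑ k, (ξ k).count (some c)) : ℝ)) ≠ 0 :=
      Finset.prod_ne_zero_iff.2 fun c _ => by
        exact_mod_cast (Nat.descFactorial_pos.2 ((hkc (some c)).trans (Nat.le_add_right n m'))).ne'
    have hD : (n.descFactorial (∑ k, (ξ k).count none) : ℝ) ≠ 0 := by exact_mod_cast (Nat.descFactorial_pos.2 (hkc none)).ne'
    have hF1 : ((n + m').factorial : ℝ) ≠ 0 := by exact_mod_cast (Nat.factorial_pos _).ne'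
    have hF2 : (n.factorial : ℝ) ≠ 0 := by exact_mod_cast (Nat.factorial_pos _).ne'
    field_simp
  have hcard : ((Finset.univ : Finset (Fin m → SlyColourPattern q j)).card : ℝ) = ((q : ℝ) ^ (2 * j) + q) ^ m := by
    rw [Finset.card_univ, Fintype.card_fun, Fintype.card_fin, card_slyColourPattern q j hj]; push_cast; ring
  rw [hsumG, Finset.sum_div]
  simp_rw [hterm]
  constructor
  · calc ((q : ℝ) ^ (2 * j) + q) ^ m * (((n : ℝ) - (m * j : ℕ)) / ((n : ℝ) + m')) ^ (2 * (m * j))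
        = ∑ _ξ : Fin m → SlyColourPattern q j, (((n : ℝ) - (m * j : ℕ)) / ((n : ℝ) + m')) ^ (2 * (m * j)) := by
          rw [Finset.sum_const, nsmul_eq_mul, hcard]
      _ ≤ _ := Finset.sum_le_sum fun ξ _ => (descFactorial_term_bounds n m' (m * j) (fun c => ∑ k, (ξ k).count c) (sum_tuple_count ξ) hn).1
  · calc _ ≤ ∑ _ξ : Fin m → SlyColourPattern q j, ((n : ℝ) / ((n : ℝ) - 2 * (m * j : ℕ))) ^ (2 * (m * j)) :=
          Finset.sum_le_sum fun ξ _ => (descFactorial_term_bounds n m' (m * j) (fun c => ∑ k, (ξ k).count c) (sum_tuple_count ξ) hn).2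
      _ = ((q : ℝ) ^ (2 * j) + q) ^ m * ((n : ℝ) / ((n : ℝ) - 2 * (m * j : ℕ))) ^ (2 * (m * j)) := by
          rw [Finset.sum_const, nsmul_eq_mul, hcard]

open scoped Classical in
/-- **Lower bound on the factorial moments of the cycle counts** (Sly's Lemma 3.7, lower half, all `n`):
`E[(2j)^m (X_{2j})_m] ≥ (q^{2j}+q)^m ((n - mj)/(n+m'))^{2mj}`. [cite: Sly2010, Lemma 3.7] -/
theorem avg_slyDistinctTuples_ge (hj : 1 ≤ j) (m : ℕ) (hn : 2 * (m * j) < n) :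
    ((q : ℝ) ^ (2 * j) + q) ^ m * (((n : ℝ) - (m * j : ℕ)) / ((n : ℝ) + m')) ^ (2 * (m * j)) ≤
      (∑ ω : (Fin q → Equiv.Perm (Fin (n + m'))) × Equiv.Perm (Fin n), (slyDistinctTuples n m' q j m ω.1 ω.2 : ℝ)) /
        ((((n + m').factorial : ℝ) ^ q) * (n.factorial : ℝ)) := by
  have hN : (0 : ℝ) < (((n + m').factorial : ℝ) ^ q) * (n.factorial : ℝ) := by
    have h1 : (0 : ℝ) < (n + m').factorial := by exact_mod_cast Nat.factorial_pos _
    have h2 : (0 : ℝ) < n.factorial := by exact_mod_cast Nat.factorial_pos _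
    positivity
  refine (sum_disjoint_div_bounds hj m hn).1.trans (div_le_div_of_nonneg_right ?_ hN.le)
  have h := sum_disjoint_le_sum_slyDistinctTuples (n := n) (m' := m') (q := q) hj m
  have h' : ((∑ f : Fin m → SlyWCycle n q j, if SlyVertexDisjoint f then
      (∏ c : Fin q, (n + m' - ∑ k, (f k).colourCount (some c)).factorial) * (n - ∑ k, (f k).colourCount none).factorial else 0 : ℕ) : ℝ) ≤
      ((∑ ω : (Fin q → Equiv.Perm (Fin (n + m'))) × Equiv.Perm (Fin n), slyDistinctTuples n m' q j m ω.1 ω.2 : ℕ) : ℝ) := by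
    exact_mod_cast h
  push_cast at h'
  refine le_trans (le_of_eq ?_) h'
  push_cast
  rfl

end DisjointMainBounds

end Literature.Computability.Complexity
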